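import Summits.ABC.StewartYu.PadicMultiquadraticLiouvilleSharp
import HarnessLib

/-!
# Cell abc-stewartyu, WP-Y (route M2 `PadicPrimesYuNinety`, infrastructure I1): the SHARP
# multiquadratic Liouville inequality `‖∑_S c_S ∏_{j∈S} sⱼ‖ ≥ D/(4D²M(∏H(αⱼ))³)^{2ᵏ}` in an ARBITRARY
# ultrametric field whose norm is `p`-adic on `ℤ` — in particular in `ℂ_p`

`Summits/ABC/StewartYu/MultiquadraticLiouvilleExt.lean` — cell `abc-stewartyu` (HOME
`run/shared/lean/pub/abc-stewartyu/`, seat p3; theorems only, no definition, no named fact), sequel to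
`PadicMultiquadraticLiouvilleSharp.lean` (the same inequality with the roots `sⱼ ∈ ℚ_p`).

WHY (lit dossier HOME/lit/SOURCES.md §11.5 (iv), §11.6 row 2, §12 row "Step 2: half points"): in the
landed Theorem-A chain (principal units `αⱼ ≡ 1 (mod p)`, `p` odd) every square root `√αⱼ` lies in
`ℚ_p` (Hensel), so the Liouville estimate at the half points of the `2`-descent runs inside `ℚ_p`
(`Multiquad.norm_evL_ge_sharp`). In Yu's twist engine for ARBITRARY `p`-adic units (Yu 1990 §2,
Lemma 2.4, pp. 53–56; the cruxes `YuNinetyThreeModFour` / `YuNinetyOneModFour` of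
`Summits/ABC/ABC/Theses/PadicPrimesYuNinety.lean`) the values at the half points are polynomials with
rational coefficients in `α₀^{1/2} = √(-1)` and `√q₁, …, √qₘ` (Yu 1990 (2.95)), evaluated in a field
`E_℘' ⊇ ℚ_p` that is NOT `ℚ_p` in general (`√(-1) ∉ ℚ_p` for `p ≡ 3 (mod 4)`, `√q ∉ ℚ_p` for a
non-residue `q`). This file re-runs the induction of `PadicMultiquadraticLiouvilleSharp.lean` with
`ℚ_p` replaced by an arbitrary normed field `L` such that

* `L` is ultrametric (`IsUltrametricDist L`) and of characteristic zero,
* `‖(z : L)‖ ≤ 1` for every integer `z` and `‖(n : L)‖ ≥ 1/n` for every positive integer `n`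
  (i.e. the norm of `L` restricted to `ℚ` is dominated by / dominates the `p`-adic one exactly as
  needed — both hold when `L` is a normed `ℚ_p`-algebra, e.g. `L = ℂ_p`, `L = ℚ_p`),

the specialisation to `L = ℂ_[p]` (Mathlib `PadicComplex`) is the sequel `PadicComplexLiouville.lean`.

Main result (namespace `Summit.ABC.StewartYu.MultiquadExt`): `norm_evL_ge_sharp_of_norm_int` — the
inequality in a general `L` as above (plus the integrality lemmas `norm_evL_le_natCast` etc. it rests
on, each under exactly the hypotheses it uses).

The algebra (`Multiquad.evL`, `evL_cmul`, `evL_ne_zero`, `evL_succ`, `evL_conjLast`) is the landed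
`PadicMultiquadratic.lean`, already stated for an arbitrary field of characteristic zero; the numeric
step `Multiquad.padic_numeric_step_sharp` is field-free. Everything is [folklore]; nothing here is
claimed to be in print. WHAT THIS IS NOT: not the half-step of the twist engine itself (that needs the
`h*`-bookkeeping of Yu 1990 (2.93)–(2.95) to exhibit the value as such an `evL`), only its Liouville
input.
-/

noncomputable section

open Finset Literature.NumberTheory.Transcendental.CW77

namespace Summit.ABC.StewartYu

namespace MultiquadExt

open Literature.NumberTheory.Transcendental Multiquad

variable {L : Type*} [NormedField L] [IsUltrametricDist L] [CharZero L] {k : ℕ}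

/-! ### Integrality and the product formula on `ℤ ⊂ L` -/

omit [IsUltrametricDist L] [CharZero L] in
/-- Integrality: a monomial of elements of norm `≤ 1` has norm `≤ 1`. [folklore] -/
theorem norm_monoL_le_one (s : Fin k → L) (hs1 : ∀ j, ‖s j‖ ≤ 1) (S : Finset (Fin k)) :
    ‖monoL s S‖ ≤ 1 := by
  unfold monoL
  rw [norm_prod]
  exact Finset.prod_le_one (fun j _ => norm_nonneg _) fun j _ => hs1 j

omit [CharZero L] in
/-- Integrality: a vector with integer coefficients evaluates to an element of norm `≤ 1`, provided
integers have norm `≤ 1` in `L`. [folklore] -/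
theorem norm_evL_le_one_of_int (hZ : ∀ z : ℤ, ‖(z : L)‖ ≤ 1) (s : Fin k → L)
    (hs1 : ∀ j, ‖s j‖ ≤ 1) {c : Finset (Fin k) → ℚ} (hint : ∀ S, ∃ z : ℤ, c S = z) :
    ‖evL s c‖ ≤ 1 := by
  unfold evL
  refine IsUltrametricDist.norm_sum_le_of_forall_le_of_nonneg zero_le_one fun S _ => ?_
  obtain ⟨z, hz⟩ := hint S
  rw [norm_mul, hz]
  have h1 : ‖((z : ℚ) : L)‖ ≤ 1 := by
    rw [Rat.cast_intCast]; exact hZ z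
  exact mul_le_one₀ h1 (norm_nonneg _) (norm_monoL_le_one s hs1 S)

omit [IsUltrametricDist L] [CharZero L] in
/-- `1/‖D‖ ≤ D` for a positive integer `D`, provided `‖D‖ ≥ 1/D` in `L`. [folklore] -/
theorem inv_norm_natCast_le (hN : ∀ n : ℕ, n ≠ 0 → (n : ℝ)⁻¹ ≤ ‖(n : L)‖) {D : ℕ} (hD : 1 ≤ D) :
    1 / ‖(D : L)‖ ≤ D := by
  have hD0 : D ≠ 0 := by omega
  have h := hN D hD0
  have hDpos : (0 : ℝ) < D := by exact_mod_cast Nat.pos_of_ne_zero hD0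
  have hnorm : 0 < ‖(D : L)‖ := lt_of_lt_of_le (by positivity) h
  rw [one_div, inv_le_comm₀ hnorm hDpos]
  exact h

omit [IsUltrametricDist L] [CharZero L] in
/-- A positive integer is non-zero in `L` when `‖n‖ ≥ 1/n`. [folklore] -/
theorem norm_natCast_pos (hN : ∀ n : ℕ, n ≠ 0 → (n : ℝ)⁻¹ ≤ ‖(n : L)‖) {D : ℕ} (hD0 : D ≠ 0) :
    0 < ‖(D : L)‖ := by
  have hDpos : (0 : ℝ) < D := by exact_mod_cast Nat.pos_of_ne_zero hD0
  exact lt_of_lt_of_le (by positivity) (hN D hD0)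

/-- A vector `c` with `D c_S ∈ ℤ` evaluates to an element of norm `≤ D`. [folklore] -/
theorem norm_evL_le_natCast (hZ : ∀ z : ℤ, ‖(z : L)‖ ≤ 1)
    (hN : ∀ n : ℕ, n ≠ 0 → (n : ℝ)⁻¹ ≤ ‖(n : L)‖) (s : Fin k → L) (hs1 : ∀ j, ‖s j‖ ≤ 1)
    {c : Finset (Fin k) → ℚ} {D : ℕ} (hD : 1 ≤ D) (hden : ∀ S, ∃ z : ℤ, (D : ℚ) * c S = z) :
    ‖evL s c‖ ≤ D := by
  have hD0 : D ≠ 0 := by omega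
  have hint : ∀ S, ∃ z : ℤ, ((D : ℚ) • c) S = z := fun S => by
    obtain ⟨z, hz⟩ := hden S; exact ⟨z, by simpa using hz⟩
  have h1 := norm_evL_le_one_of_int hZ s hs1 hint
  rw [evL_smul, norm_mul, Rat.cast_natCast] at h1
  have hnorm : 0 < ‖(D : L)‖ := norm_natCast_pos hN hD0
  have h2 : ‖evL s c‖ ≤ 1 / ‖(D : L)‖ := by
    rw [le_div_iff₀ hnorm]; linarith [h1]
  exact h2.trans (inv_norm_natCast_le hN hD)

omit [IsUltrametricDist L] [CharZero L] in
/-- `‖z‖ ≥ 1/|z|` for a non-zero integer `z`, provided `‖n‖ ≥ 1/n` on positive integers. [folklore] -/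
theorem inv_abs_le_norm_intCast (hN : ∀ n : ℕ, n ≠ 0 → (n : ℝ)⁻¹ ≤ ‖(n : L)‖) {z : ℤ}
    (hz : z ≠ 0) : 1 / |(z : ℝ)| ≤ ‖(z : L)‖ := by
  have hn : z.natAbs ≠ 0 := Int.natAbs_ne_zero.mpr hz
  have h := hN z.natAbs hn
  have habs : |(z : ℝ)| = (z.natAbs : ℝ) := by
    rw [← Int.cast_natCast, Int.natCast_natAbs, Int.cast_abs]
  have hnorm : ‖(z : L)‖ = ‖((z.natAbs : ℕ) : L)‖ := by
    rcases Int.natAbs_eq z with h' | h'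
    · conv_lhs => rw [h']
      simp
    · conv_lhs => rw [h']
      simp
  rw [habs, hnorm, one_div]
  exact h

/-! ### The base of the induction -/

omit [IsUltrametricDist L] in
/-- The base of the induction (no roots): a non-zero rational `c_∅ = z/D` with `|c_∅| ≤ M` has
`‖c_∅‖ ≥ ‖z‖ ≥ 1/|z| ≥ 1/(DM)` in `L`. [folklore] -/
theorem norm_evL_ge_base (hZ : ∀ z : ℤ, ‖(z : L)‖ ≤ 1)
    (hN : ∀ n : ℕ, n ≠ 0 → (n : ℝ)⁻¹ ≤ ‖(n : L)‖) (s : Fin 0 → L) {c : Finset (Fin 0) → ℚ}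
    (hc : c ≠ 0) {D : ℕ} (hD : 1 ≤ D) (hden : ∀ S, ∃ z : ℤ, (D : ℚ) * c S = z) {M : ℝ}
    (hcM : ∑ S, |(c S : ℝ)| ≤ M) :
    1 / ((D : ℝ) * M) ≤ ‖evL s c‖ := by
  have huniv : (univ : Finset (Finset (Fin 0))) = {∅} := by
    ext S
    simp only [Finset.mem_univ, Finset.mem_singleton, true_iff]
    exact Finset.eq_empty_of_isEmpty S
  have hev : evL s c = ((c ∅ : ℚ) : L) := by
    unfold evL
    rw [huniv, Finset.sum_singleton]
    unfold monoL
    rw [Finset.prod_empty, mul_one]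
  have hc0 : c ∅ ≠ 0 := by
    intro h; apply hc; funext S
    have : S = ∅ := Finset.eq_empty_of_isEmpty S
    rw [this, h]; rfl
  obtain ⟨z, hz⟩ := hden ∅
  have hD0 : (D : ℚ) ≠ 0 := by exact_mod_cast (show D ≠ 0 by omega)
  have hz0 : z ≠ 0 := by
    rintro rfl
    rw [Int.cast_zero, mul_eq_zero] at hz
    rcases hz with h | h
    · exact hD0 h
    · exact hc0 h
  have hcz : c ∅ = (z : ℚ) / D := by
    field_simp; rw [mul_comm]; exact hz
  have hcM' : |((c ∅ : ℚ) : ℝ)| ≤ M := by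
    have : |((c ∅ : ℚ) : ℝ)| ≤ ∑ S, |(c S : ℝ)| := by
      rw [huniv, Finset.sum_singleton]
    exact this.trans hcM
  have hDR : (0 : ℝ) < D := by exact_mod_cast (show 0 < D by omega)
  have hzle : |(z : ℝ)| ≤ D * M := by
    have h1 : ((c ∅ : ℚ) : ℝ) = (z : ℝ) / D := by rw [hcz]; push_cast; rfl
    rw [h1, abs_div, abs_of_pos hDR, div_le_iff₀ hDR] at hcM'
    linarith [hcM']
  have hzabs : (0 : ℝ) < |(z : ℝ)| := by
    have : (z : ℝ) ≠ 0 := by exact_mod_cast hz0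
    exact abs_pos.mpr this
  have hnormD : ‖(D : L)‖ ≤ 1 := by
    have := hZ (D : ℤ)
    simpa using this
  have hnormD0 : 0 < ‖(D : L)‖ := norm_natCast_pos hN (show D ≠ 0 by omega)
  have hge : ‖(z : L)‖ ≤ ‖evL s c‖ := by
    rw [hev, hcz, Rat.cast_div, Rat.cast_intCast, Rat.cast_natCast, norm_div]
    rw [le_div_iff₀ hnormD0]
    calc ‖(z : L)‖ * ‖(D : L)‖ ≤ ‖(z : L)‖ * 1 :=
          mul_le_mul_of_nonneg_left hnormD (norm_nonneg _)
      _ = ‖(z : L)‖ := mul_one _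
  have hz1 : 1 / |(z : ℝ)| ≤ ‖(z : L)‖ := inv_abs_le_norm_intCast hN hz0
  calc 1 / ((D : ℝ) * M) ≤ 1 / |(z : ℝ)| := one_div_le_one_div_of_le hzabs hzle
    _ ≤ ‖(z : L)‖ := hz1
    _ ≤ ‖evL s c‖ := hge

/-! ### The sharp inequality in a general ultrametric field -/

set_option maxHeartbeats 800000 in
/-- **The SHARP multiquadratic Liouville inequality in an arbitrary ultrametric field `L` whose norm is
`p`-adic on `ℤ`** (`‖z‖ ≤ 1` for integers, `‖n‖ ≥ 1/n` for positive integers). Let `αⱼ ∈ ℚ` have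
`𝔽₂`-independent square classes (no non-empty sub-product is a square in `ℚ`) and let `sⱼ ∈ L` satisfy
`sⱼ² = αⱼ`, `‖sⱼ‖ ≤ 1`. If `c ≠ 0`, `D c_S ∈ ℤ` for all `S` and `∑ |c_S| ≤ M` (`D, M ≥ 1`), then
`‖∑_S c_S ∏_{j∈S} sⱼ‖ ≥ D / (4 D² M (∏ⱼ H(αⱼ))³)^{2ᵏ}`, `H(α) = max(|num α|, den α)`.
Proof: verbatim the induction of `Multiquad.norm_evL_ge_sharp` (conjugate `x̄ = u − sₖ v`, norm
`x x̄ = u² − αₖ v²` via `evL_cmul`, `x̄ ≠ 0` by `evL_ne_zero`, `‖x̄‖ ≤ D`, base case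
`‖z/D‖ ≥ ‖z‖ ≥ 1/|z|`), with the two `ℚ_p`-facts replaced by the hypotheses `hZ`, `hN`. This is the
Liouville input of the half-step of Yu's twist engine (Yu 1990 Lemma 2.4), whose values live in a
finite extension of `ℚ_p`. [folklore] -/
theorem norm_evL_ge_sharp_of_norm_int (hZ : ∀ z : ℤ, ‖(z : L)‖ ≤ 1)
    (hN : ∀ n : ℕ, n ≠ 0 → (n : ℝ)⁻¹ ≤ ‖(n : L)‖) : ∀ (k : ℕ) (α : Fin k → ℚ),
    (∀ T : Finset (Fin k), T.Nonempty → ¬ IsSquare (∏ j ∈ T, α j)) →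
    ∀ (s : Fin k → L), (∀ j, s j * s j = (α j : L)) → (∀ j, ‖s j‖ ≤ 1) →
    ∀ (c : Finset (Fin k) → ℚ), c ≠ 0 → ∀ (D : ℕ), 1 ≤ D → (∀ S, ∃ z : ℤ, (D : ℚ) * c S = z) →
    ∀ (M : ℝ), 1 ≤ M → ∑ S, |(c S : ℝ)| ≤ M →
    (D : ℝ) / (4 * (D : ℝ) ^ 2 * M * heightProd α ^ 3) ^ (2 ^ k) ≤ ‖evL s c‖ := by
  intro k
  induction k with
  | zero =>
    intro α hind s hs hs1 c hc D hD hden M hM hcM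
    have hbase := norm_evL_ge_base hZ hN s hc hD hden hcM
    have hP : heightProd α = 1 := by unfold heightProd; simp
    rw [hP, one_pow, mul_one, pow_zero, pow_one]
    have hD1 : (1 : ℝ) ≤ D := by exact_mod_cast hD
    have hDM : 0 < (D : ℝ) * M := by positivity
    refine le_trans ?_ hbase
    rw [div_le_div_iff₀ (by positivity) hDM]
    nlinarith
  | succ k ih =>
    intro α' hind s' hs' hs1' c hc D hD hden M hM hcM
    set a : ℚ := α' (Fin.last k) with ha
    set α : Fin k → ℚ := init α' with hαdef
    set s : Fin k → L := initL s' with hsdef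
    have hs : ∀ j, s j * s j = (α j : L) := fun j => hs' _
    have hs1 : ∀ j, ‖s j‖ ≤ 1 := fun j => hs1' _
    have hindα : ∀ T : Finset (Fin k), T.Nonempty → ¬ IsSquare (∏ j ∈ T, α j) := hind_init α' hind
    set H : ℝ := hgt a with hH
    set P : ℝ := heightProd α with hP
    have hH1 : 1 ≤ H := one_le_hgt a
    have hP1 : 1 ≤ P := one_le_heightProd α
    have hP' : heightProd α' = P * H := by
      rw [hP, hH, ha]; unfold heightProd; rw [Fin.prod_univ_castSucc]
    have hD1 : (1 : ℝ) ≤ D := by exact_mod_cast hD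
    set u : L := evL s (lo c) with hu
    set v : L := evL s (hi c) with hv
    set r : L := s' (Fin.last k) with hr
    have hrr : r * r = (a : L) := hs' (Fin.last k)
    have hx : evL s' c = u + r * v := evL_succ s' c
    have hsum := sum_abs_succ c
    have hlo_le : ∑ S, |(lo c S : ℝ)| ≤ M := by
      have : 0 ≤ ∑ S, |(hi c S : ℝ)| := Finset.sum_nonneg fun S _ => abs_nonneg _
      linarith
    have hhi_le : ∑ S, |(hi c S : ℝ)| ≤ M := by
      have : 0 ≤ ∑ S, |(lo c S : ℝ)| := Finset.sum_nonneg fun S _ => abs_nonneg _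
      linarith
    have hden_lo : ∀ S, ∃ z : ℤ, (D : ℚ) * lo c S = z := fun S => hden _
    have hden_hi : ∀ S, ∃ z : ℤ, (D : ℚ) * hi c S = z := fun S => hden _
    have hE : 2 ^ (k + 1) = 2 * 2 ^ k := by ring
    rcases eq_or_ne (hi c) 0 with hhi0 | hhi0
    · -- no last root
      have hlo0 : lo c ≠ 0 := (lo_hi_ne_zero hc).resolve_right (fun h => h hhi0)
      have key := ih α hindα s hs hs1 (lo c) hlo0 D hD hden_lo M hM hlo_le
      have hv0 : v = 0 := by rw [hv, hhi0, evL_zero]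
      have hx' : evL s' c = u := by rw [hx, hv0]; ring
      rw [hx']
      refine le_trans ?_ key
      rw [hP']
      have hb1 : (1 : ℝ) ≤ 4 * (D : ℝ) ^ 2 * M * P ^ 3 := by
        have := one_le_mul_of_one_le_of_one_le
          (one_le_mul_of_one_le_of_one_le (one_le_pow₀ hD1 (n := 2)) hM)
          (one_le_pow₀ hP1 (n := 3))
        nlinarith
      have hb : 4 * (D : ℝ) ^ 2 * M * P ^ 3 ≤ 4 * (D : ℝ) ^ 2 * M * (P * H) ^ 3 := by
        have hPH : P ^ 3 ≤ (P * H) ^ 3 :=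
          pow_le_pow_left₀ (by positivity) (le_mul_of_one_le_right (by positivity) hH1) 3
        exact mul_le_mul_of_nonneg_left hPH (by positivity)
      apply div_le_div_of_nonneg_left (by positivity) (by positivity)
      calc (4 * (D : ℝ) ^ 2 * M * P ^ 3) ^ 2 ^ k ≤ (4 * (D : ℝ) ^ 2 * M * (P * H) ^ 3) ^ 2 ^ k :=
            pow_le_pow_left₀ (by positivity) hb _
        _ ≤ (4 * (D : ℝ) ^ 2 * M * (P * H) ^ 3) ^ 2 ^ (k + 1) :=
            pow_le_pow_right₀ (hb1.trans hb) (Nat.pow_le_pow_right (by norm_num) (by omega))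
    · -- the conjugate and the norm
      set c'' : Finset (Fin k) → ℚ := cmul α (lo c) (lo c) - a • cmul α (hi c) (hi c) with hc''
      have hev'' : evL s c'' = u * u - (a : L) * (v * v) := by
        rw [hc'', evL_sub, evL_smul, evL_cmul α s hs, evL_cmul α s hs]
      have hxbar : evL s' (conjLast c) = u - r * v := evL_conjLast s' c
      have hxbar0 : evL s' (conjLast c) ≠ 0 := evL_ne_zero α' hind s' hs' (conjLast_ne_zero hc)
      have hx0 : evL s' c ≠ 0 := evL_ne_zero α' hind s' hs' hc
      have hnorm : evL s' c * evL s' (conjLast c) = evL s c'' := by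
        rw [hx, hxbar, hev'', ← hrr]; ring
      have hc''0 : c'' ≠ 0 := by
        intro h0
        have : evL s c'' = 0 := by rw [h0, evL_zero]
        rw [← hnorm] at this
        rcases mul_eq_zero.mp this with h | h
        · exact hx0 h
        · exact hxbar0 h
      set Dd : ℕ := D * D * ∏ j, (α j).den with hDd
      set D'' : ℕ := Dd * a.den with hD''
      have hden'' : ∀ U, ∃ z : ℤ, (D'' : ℚ) * c'' U = z := by
        intro U
        obtain ⟨z₁, hz₁⟩ := exists_int_cmul α (lo c) (lo c) hden_lo hden_lo U
        obtain ⟨z₂, hz₂⟩ := exists_int_cmul α (hi c) (hi c) hden_hi hden_hi U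
        refine ⟨a.den * z₁ - a.num * z₂, ?_⟩
        rw [hc'', hD'']
        simp only [Pi.sub_apply, Pi.smul_apply, smul_eq_mul]
        push_cast
        rw [← hDd] at hz₁ hz₂
        have ha' : (a.den : ℚ) * a = a.num := by rw [mul_comm]; exact Rat.mul_den_eq_num a
        calc ((Dd : ℚ) * a.den) * (cmul α (lo c) (lo c) U - a * cmul α (hi c) (hi c) U)
            = (a.den : ℚ) * ((Dd : ℚ) * cmul α (lo c) (lo c) U) -
              ((a.den : ℚ) * a) * ((Dd : ℚ) * cmul α (hi c) (hi c) U) := by ring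
          _ = (a.den : ℚ) * z₁ - (a.num : ℚ) * z₂ := by rw [hz₁, hz₂, ha']
      have hD''1 : 1 ≤ D'' := by
        rw [hD'', hDd]
        have h1 : 1 ≤ ∏ j, (α j).den := Finset.one_le_prod' fun j _ => (α j).pos
        have := a.pos
        have : 1 ≤ D * D := Nat.one_le_iff_ne_zero.mpr (by positivity)
        exact Nat.one_le_iff_ne_zero.mpr (by positivity)
      have hD''le : (D'' : ℝ) ≤ D ^ 2 * P * H := by
        rw [hD'', hDd]; push_cast
        have h1 : ((∏ j, ((α j).den : ℝ))) ≤ P := by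
          have := prod_den_le α; push_cast at this; exact this
        have h2 : ((a.den : ℝ)) ≤ H := den_le_hgt a
        calc (D : ℝ) * D * (∏ j, ((α j).den : ℝ)) * a.den ≤ (D : ℝ) * D * P * H :=
            mul_le_mul (mul_le_mul_of_nonneg_left h1 (by positivity)) h2 (by positivity)
              (by positivity)
          _ = (D : ℝ) ^ 2 * P * H := by ring
      have hD''ge : (D : ℝ) ^ 2 ≤ D'' := by
        rw [hD'', hDd]; push_cast
        have h1 : (1 : ℝ) ≤ ∏ j, ((α j).den : ℝ) := by
          rw [← Nat.cast_prod]; exact_mod_cast Finset.one_le_prod' fun j _ => (α j).pos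
        have h2 : (1 : ℝ) ≤ (a.den : ℝ) := by exact_mod_cast a.pos
        calc (D : ℝ) ^ 2 = (D : ℝ) * D * 1 * 1 := by ring
          _ ≤ (D : ℝ) * D * (∏ j, ((α j).den : ℝ)) * a.den :=
              mul_le_mul (mul_le_mul_of_nonneg_left h1 (by positivity)) h2 zero_le_one
                (by positivity)
      set M'' : ℝ := 2 * H * P * M ^ 2 with hM''
      have hPabs : ∏ j, max 1 |(α j : ℝ)| ≤ P := prod_max_one_abs_le α
      have hc''M : ∑ U, |(c'' U : ℝ)| ≤ M'' := by
        have h1 := l1_cmul_le α (lo c) (lo c)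
        have h2 := l1_cmul_le α (hi c) (hi c)
        have hlo2 : (∑ S, |(lo c S : ℝ)|) * ∑ S, |(lo c S : ℝ)| ≤ M ^ 2 := by
          rw [sq]; exact mul_le_mul hlo_le hlo_le (Finset.sum_nonneg fun _ _ => abs_nonneg _)
            (by linarith)
        have hhi2 : (∑ S, |(hi c S : ℝ)|) * ∑ S, |(hi c S : ℝ)| ≤ M ^ 2 := by
          rw [sq]; exact mul_le_mul hhi_le hhi_le (Finset.sum_nonneg fun _ _ => abs_nonneg _)
            (by linarith)
        have hA : ∑ U, |(cmul α (lo c) (lo c) U : ℝ)| ≤ P * M ^ 2 :=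
          h1.trans (mul_le_mul hPabs hlo2 (by positivity) (by positivity))
        have hB : ∑ U, |(cmul α (hi c) (hi c) U : ℝ)| ≤ P * M ^ 2 :=
          h2.trans (mul_le_mul hPabs hhi2 (by positivity) (by positivity))
        have haH : |(a : ℝ)| ≤ H := abs_le_hgt a
        calc ∑ U, |(c'' U : ℝ)|
            ≤ ∑ U, (|(cmul α (lo c) (lo c) U : ℝ)| +
                |(a : ℝ)| * |(cmul α (hi c) (hi c) U : ℝ)|) := by
              refine Finset.sum_le_sum fun U _ => ?_
              rw [hc'']
              simp only [Pi.sub_apply, Pi.smul_apply, smul_eq_mul, Rat.cast_sub, Rat.cast_mul]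
              calc |(cmul α (lo c) (lo c) U : ℝ) - (a : ℝ) * cmul α (hi c) (hi c) U|
                  ≤ |(cmul α (lo c) (lo c) U : ℝ)| + |(a : ℝ) * cmul α (hi c) (hi c) U| :=
                    abs_sub _ _
                _ = _ := by rw [abs_mul]
          _ = ∑ U, |(cmul α (lo c) (lo c) U : ℝ)| +
                |(a : ℝ)| * ∑ U, |(cmul α (hi c) (hi c) U : ℝ)| := by
              rw [Finset.sum_add_distrib, Finset.mul_sum]
          _ ≤ P * M ^ 2 + H * (P * M ^ 2) :=
              add_le_add hA (mul_le_mul haH hB (by positivity) (by positivity))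
          _ ≤ M'' := by
              have : P * M ^ 2 ≤ H * (P * M ^ 2) := le_mul_of_one_le_left (by positivity) hH1
              rw [hM'']; linarith
      have hM''1 : 1 ≤ M'' := by
        rw [hM'']
        have h1 : 1 ≤ H * P * M ^ 2 :=
          one_le_mul_of_one_le_of_one_le (one_le_mul_of_one_le_of_one_le hH1 hP1)
            (one_le_pow₀ hM)
        linarith
      have key := ih α hindα s hs hs1 c'' hc''0 D'' hD''1 hden'' M'' hM''1 hc''M
      -- `‖x̄‖ ≤ D`
      have hden_conj : ∀ S, ∃ z : ℤ, (D : ℚ) * conjLast c S = z := by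
        intro S
        obtain ⟨z, hz⟩ := hden S
        unfold conjLast
        split_ifs
        · exact ⟨-z, by rw [mul_neg, hz, Int.cast_neg]⟩
        · exact ⟨z, hz⟩
      have hxbar_le : ‖evL s' (conjLast c)‖ ≤ D :=
        norm_evL_le_natCast hZ hN s' hs1' hD hden_conj
      have hxyz : ‖evL s c''‖ ≤ ‖evL s' c‖ * D := by
        rw [← hnorm, norm_mul]
        exact mul_le_mul_of_nonneg_left hxbar_le (norm_nonneg _)
      rw [hP', hE]
      rw [hM''] at key
      exact padic_numeric_step_sharp hD1 hM hH1 hP1 hD''ge hD''le key hxyz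

end MultiquadExt

end Summit.ABC.StewartYu

end
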